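import Summits.AtomisticToContinuum.BoseEinsteinCondensation.Theorems.BECStronglyRayleighLatticeToPeriodicBridgeMuffinTinMaxwellDanskin
import Summits.AtomisticToContinuum.BoseEinsteinCondensation.Theorems.BECStronglyRayleighLatticeToPeriodicBridgeCellPairSumRule
import Literature.MathematicalPhysics.QuantumManyBody.MeanSelfDensity
import Literature.MathematicalPhysics.QuantumManyBody.TorusFockLayer
import Literature.MathematicalPhysics.QuantumManyBody.PeriodicBoseGasThm31

/-!
# Route `BECStronglyRayleigh`, crux `LatticeToPeriodicBridge` (stmt-AtomisticToContinuum-9674),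
# line `muffin-tin-reward-supermodularity` — the CONFINEMENT BOUND on the constant-mode occupation

Helper file of the crux line `muffin-tin-reward-supermodularity` (skeleton
`Summits/AtomisticToContinuum/BoseEinsteinCondensation/Cruxes/LatticeToPeriodicBridge/Lines/muffin_tin_reward_supermodularity.lean`,
lead prover-line-stmt-AtomisticToContinuum-9674-c2-0, `--supports stmt-AtomisticToContinuum-9674`), first half of the
DOWN direction for the registered open stub `stub_deepWallGerm` (S1a, the comparison sign `n₀⁺(λ,0) ≤ n₀⁺(0,0)` in its
energy-germ form): it quantifies how much of the constant mode a state CAN occupy once its mass sits in the wells of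
the thick muffin tin (`wallCount`, `wallEnergy` of the line's Defs module).

**Main result** (`DownSandwich.condensateOccupation_le_confinement`). For every periodic trial state `Ψ` of `N`
bosons on the torus of side `L > 0`, every muffin tin with `M ≥ 1` periods per axis and wall fraction `w ≤ 1`, and
every `η > 0`,

`n₀(Ψ) ≤ (1+η)(1-w)³·N + (1+η⁻¹)·N·⟨W⟩_Ψ`.

Proof: `n₀(Ψ) = ∫_{cell^{N-1}} |√N L^{-3/2} ∫_cell Ψ(x,Y) dx|² dY` (`condensateOccupation_eq_lintegral_modeAn_constantMode`);
split the `x`-integral over the cell into the well part (no coordinate in a wall slab) and the wall part,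
`|a+b|² ≤ (1+η)|a|² + (1+η⁻¹)|b|²`, Cauchy–Schwarz on each part (`sq_nnnorm_setIntegral_le` of the coarse-cell toolkit),
`|cell ∩ wells| ≤ (1-w)³L³` (cover by the `M³` well cubes) and `|cell| = L³`, and `1_{wall}(x) ≤ g(x) := Σ_k 1{fract(Mx_k/L) < w}`
with `g(X₀) ≤ wallCount X`; Tonelli along the first particle gives the two terms `(1+η)(1-w)³ N ∫|Ψ|² = (1+η)(1-w)³N` and
`(1+η⁻¹) N ∫ g(X₀)|Ψ|² ≤ (1+η⁻¹) N ⟨W⟩_Ψ` (no Bose symmetry is used: the factor `N` is kept instead).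

The sequel `…MuffinTinDeepWallsDepleteOfFloor.lean` turns this into `n₀⁺(λ,0) ≤ ((1-w)³+ε)N` eventually in `λ` and into the
pointwise DOWN statement `(1-w)³N < n₀⁺(0,0) ⟹ DeepWallGerm at (v,N,L,M,w)`.

References: LSSY2005 App. A (A.11), (A.13); Fournais2020 (1.3)–(1.5) (`n₀`, the constant mode); folklore measure theory.
-/

noncomputable section

namespace Summit.AtomisticToContinuum.BoseEinsteinCondensation.Cruxes.LatticeToPeriodicBridge.MuffinTinRewardSupermodularity

open MeasureTheory Filter
open scoped ENNReal NNReal Topology ComplexConjugate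
open Literature.MathematicalPhysics.QuantumManyBody.BoseGas
open Summit.AtomisticToContinuum.BoseEinsteinCondensation.Theses
open Summit.AtomisticToContinuum.BoseEinsteinCondensation.Theses.BECStronglyRayleigh

namespace DownSandwich

variable {N : ℕ} {L : ℝ}

/-! ## The one-particle wall weight and the well region -/

/-! Throughout, the ONE-PARTICLE WALL WEIGHT is the expression `g(x) = Σ_k 1{fract(M x_k/L) < w}` (so that
`wallCount X = Σᵢ g(Xᵢ)` definitionally) and the WELL REGION is `{x | ∀ k, w ≤ fract(M x_k/L)}` (no coordinate in a
wall slab); both are written out in the statements (no auxiliary definitions in this proof file). -/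

/-- `wallCount X = Σᵢ g(Xᵢ)` (definitional). [folklore] -/
theorem wallCount_eq_sum_wallWeight (M : ℕ) (L w : ℝ) (X : Config N) :
    wallCount M L w X = ∑ i, ∑ k : Fin 3, if Int.fract ((M : ℝ) * X i k / L) < w then (1 : ℝ≥0∞) else 0 := rfl

/-- The scaled fractional part of a coordinate is measurable. [folklore] -/
theorem measurable_fract_coord (M : ℕ) (L : ℝ) (k : Fin 3) :
    Measurable fun x : Space => Int.fract ((M : ℝ) * x k / L) := by
  have h : Measurable fun x : Space => (M : ℝ) * x k / L := by fun_prop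
  exact measurable_fract.comp h

/-- The wall weight is measurable. [folklore] -/
theorem measurable_wallWeight (M : ℕ) (L w : ℝ) :
    Measurable fun x : Space => ∑ k : Fin 3, if Int.fract ((M : ℝ) * x k / L) < w then (1 : ℝ≥0∞) else 0 := by
  refine Finset.measurable_sum _ fun k _ => ?_
  exact Measurable.ite (measurableSet_lt (measurable_fract_coord M L k) measurable_const)
    measurable_const measurable_const

/-- The well region is measurable. [folklore] -/
theorem measurableSet_wellSet (M : ℕ) (L w : ℝ) :
    MeasurableSet {x : Space | ∀ k, w ≤ Int.fract ((M : ℝ) * x k / L)} := by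
  have h : {x : Space | ∀ k, w ≤ Int.fract ((M : ℝ) * x k / L)} =
      ⋂ k : Fin 3, {x : Space | w ≤ Int.fract ((M : ℝ) * x k / L)} := by
    ext x; simp
  rw [h]
  exact MeasurableSet.iInter fun k => measurableSet_le measurable_const (measurable_fract_coord M L k)

/-- Off the wells the wall weight is at least `1`. [folklore] -/
theorem one_le_wallWeight_of_not_mem {M : ℕ} {L w : ℝ} {x : Space}
    (hx : x ∉ {x : Space | ∀ k, w ≤ Int.fract ((M : ℝ) * x k / L)}) :
    1 ≤ ∑ k : Fin 3, if Int.fract ((M : ℝ) * x k / L) < w then (1 : ℝ≥0∞) else 0 := by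
  simp only [Set.mem_setOf_eq, not_forall, not_le] at hx
  obtain ⟨k, hk⟩ := hx
  calc (1 : ℝ≥0∞) = if Int.fract ((M : ℝ) * x k / L) < w then 1 else 0 := by rw [if_pos hk]
    _ ≤ ∑ k : Fin 3, if Int.fract ((M : ℝ) * x k / L) < w then (1 : ℝ≥0∞) else 0 :=
        Finset.single_le_sum (f := fun k => if Int.fract ((M : ℝ) * x k / L) < w then (1 : ℝ≥0∞) else 0)
          (fun _ _ => zero_le) (Finset.mem_univ k)

/-- The wall weight of the first particle is at most the wall count of the configuration. [folklore] -/
theorem wallWeight_le_wallCount (M : ℕ) (L w : ℝ) {n : ℕ} (X : Config (n + 1)) :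
    (∑ k : Fin 3, if Int.fract ((M : ℝ) * X 0 k / L) < w then (1 : ℝ≥0∞) else 0) ≤ wallCount M L w X := by
  rw [wallCount_eq_sum_wallWeight]
  exact Finset.single_le_sum
    (f := fun i => ∑ k : Fin 3, if Int.fract ((M : ℝ) * X i k / L) < w then (1 : ℝ≥0∞) else 0)
    (fun _ _ => zero_le) (Finset.mem_univ 0)

/-- Volume of the well part of the cell: `|cell ∩ wells| ≤ (1-w)³ L³`. [folklore] -/
theorem volume_cell_inter_wellSet_le {M : ℕ} (hM : 0 < M) (hL : 0 < L) {w : ℝ} (hw1 : w ≤ 1) :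
    volume (cell L ∩ {x : Space | ∀ k, w ≤ Int.fract ((M : ℝ) * x k / L)}) ≤
      ENNReal.ofReal ((1 - w) ^ 3 * L ^ 3) := by
  set b : ℝ := L / M with hb
  have hM0 : (0 : ℝ) < M := by exact_mod_cast hM
  have hbpos : 0 < b := div_pos hL hM0
  -- the `M³` well cubes
  let cube : (Fin 3 → Fin M) → Set Space := fun d =>
    {x | ∀ k, ((d k : ℕ) + w) * b ≤ x k ∧ x k < ((d k : ℕ) + 1) * b}
  -- cover
  have hcover : cell L ∩ {x : Space | ∀ k, w ≤ Int.fract ((M : ℝ) * x k / L)} ⊆ ⋃ d, cube d := by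
    rintro x ⟨hxc, hxw⟩
    have hs : ∀ k, 0 ≤ (M : ℝ) * x k / L ∧ (M : ℝ) * x k / L < M := by
      intro k
      have h0 := (hxc k).1
      have h1 := (hxc k).2
      refine ⟨by positivity, ?_⟩
      rw [div_lt_iff₀ hL]
      exact mul_lt_mul_of_pos_left h1 hM0
    have hfl : ∀ k, ⌊(M : ℝ) * x k / L⌋₊ < M := fun k => (Nat.floor_lt (hs k).1).2 (hs k).2
    let dfun : Fin 3 → Fin M := fun k => ⟨⌊(M : ℝ) * x k / L⌋₊, hfl k⟩
    refine Set.mem_iUnion.2 ⟨dfun, fun k => ?_⟩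
    change (((⌊(M : ℝ) * x k / L⌋₊ : ℕ) : ℝ) + w) * b ≤ x k ∧
      x k < (((⌊(M : ℝ) * x k / L⌋₊ : ℕ) : ℝ) + 1) * b
    set s : ℝ := (M : ℝ) * x k / L with hsdef
    have hs0 : 0 ≤ s := (hs k).1
    have hxs : x k = s * b := by rw [hsdef, hb]; field_simp
    have hfloor : ((⌊s⌋₊ : ℕ) : ℝ) = (⌊s⌋ : ℝ) := by
      rw [← Int.natCast_floor_eq_floor hs0, Int.cast_natCast]
    have hfr : Int.fract s = s - (⌊s⌋₊ : ℝ) := by rw [hfloor]; rfl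
    have hw' : w ≤ Int.fract s := hxw k
    rw [hfr] at hw'
    have hlt : s < (⌊s⌋₊ : ℝ) + 1 := Nat.lt_floor_add_one s
    constructor
    · calc (((⌊s⌋₊ : ℕ) : ℝ) + w) * b ≤ s * b := mul_le_mul_of_nonneg_right (by linarith) hbpos.le
        _ = x k := hxs.symm
    · calc x k = s * b := hxs
        _ < (((⌊s⌋₊ : ℕ) : ℝ) + 1) * b := mul_lt_mul_of_pos_right hlt hbpos
  -- volume of one cube
  have hvol : ∀ d, volume (cube d) = ENNReal.ofReal ((1 - w) * b) ^ 3 := by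
    intro d
    have h : cube d = (@WithLp.ofLp 2 (Fin 3 → ℝ)) ⁻¹'
        (Set.univ.pi fun k => Set.Ico ((((d k : ℕ) : ℝ) + w) * b) ((((d k : ℕ) : ℝ) + 1) * b)) := by
      ext x; simp [cube]
    rw [h, (PiLp.volume_preserving_ofLp (Fin 3)).measure_preimage
      (MeasurableSet.univ_pi fun _ => measurableSet_Ico).nullMeasurableSet, volume_pi_pi]
    have hring : ∀ t : ℝ, (t + 1) * b - (t + w) * b = (1 - w) * b := fun t => by ring
    simp only [Real.volume_Ico, hring, Finset.prod_const, Finset.card_univ, Fintype.card_fin]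
  calc volume (cell L ∩ {x : Space | ∀ k, w ≤ Int.fract ((M : ℝ) * x k / L)})
      ≤ volume (⋃ d, cube d) := measure_mono hcover
    _ ≤ ∑ d, volume (cube d) := measure_iUnion_fintype_le _ _
    _ = ∑ _d : Fin 3 → Fin M, ENNReal.ofReal ((1 - w) * b) ^ 3 := by simp only [hvol]
    _ = (M : ℝ≥0∞) ^ 3 * ENNReal.ofReal ((1 - w) * b) ^ 3 := by
        rw [Finset.sum_const, Finset.card_univ, Fintype.card_fun, Fintype.card_fin, Fintype.card_fin,
          nsmul_eq_mul]
        push_cast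
        ring
    _ = ENNReal.ofReal ((1 - w) ^ 3 * L ^ 3) := by
        rw [← mul_pow, ← ENNReal.ofReal_natCast, ← ENNReal.ofReal_mul hM0.le,
          ← ENNReal.ofReal_pow (by positivity)]
        congr 1
        rw [hb]
        field_simp

/-! ## The elementary split inequality -/

/-- `‖a + b‖² ≤ (1+η)‖a‖² + (1+η⁻¹)‖b‖²` in `ℝ≥0∞`. [folklore] -/
theorem ennnorm_add_sq_le {η : ℝ} (hη : 0 < η) (a b : ℂ) :
    ((‖a + b‖₊ : ℝ≥0∞)) ^ 2 ≤
      ENNReal.ofReal (1 + η) * (‖a‖₊ : ℝ≥0∞) ^ 2 + ENNReal.ofReal (1 + η⁻¹) * (‖b‖₊ : ℝ≥0∞) ^ 2 := by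
  have hx := norm_nonneg a
  have hy := norm_nonneg b
  have key : 2 * ‖a‖ * ‖b‖ ≤ η * ‖a‖ ^ 2 + η⁻¹ * ‖b‖ ^ 2 := by
    have h : η * ‖a‖ ^ 2 + η⁻¹ * ‖b‖ ^ 2 - 2 * ‖a‖ * ‖b‖ = η⁻¹ * (η * ‖a‖ - ‖b‖) ^ 2 := by
      field_simp
      ring
    have h2 : 0 ≤ η⁻¹ * (η * ‖a‖ - ‖b‖) ^ 2 := by positivity
    linarith
  have hreal : ‖a + b‖ ^ 2 ≤ (1 + η) * ‖a‖ ^ 2 + (1 + η⁻¹) * ‖b‖ ^ 2 := by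
    have h1 : ‖a + b‖ ^ 2 ≤ (‖a‖ + ‖b‖) ^ 2 :=
      pow_le_pow_left₀ (norm_nonneg _) (norm_add_le a b) 2
    nlinarith
  rw [coe_nnnorm_sq_eq_ofReal, coe_nnnorm_sq_eq_ofReal, coe_nnnorm_sq_eq_ofReal,
    ← ENNReal.ofReal_mul (by positivity), ← ENNReal.ofReal_mul (by positivity),
    ← ENNReal.ofReal_add (by positivity) (by positivity)]
  exact ENNReal.ofReal_le_ofReal hreal

/-- The slice estimate: for a continuous `f` on the cell,
`‖∫_cell f‖² ≤ (1+η)|cell ∩ wells| ∫_cell ‖f‖² + (1+η⁻¹)|cell| ∫_cell g‖f‖²`. [folklore] -/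
theorem sq_nnnorm_setIntegral_cell_le (M : ℕ) (L w : ℝ) {η : ℝ} (hη : 0 < η) {f : Space → ℂ}
    (hf : Continuous f) :
    ((‖∫ x in cell L, f x‖₊ : ℝ≥0∞)) ^ 2 ≤
      ENNReal.ofReal (1 + η) * volume (cell L ∩ {x : Space | ∀ k, w ≤ Int.fract ((M : ℝ) * x k / L)}) *
          (∫⁻ x in cell L, (‖f x‖₊ : ℝ≥0∞) ^ 2) +
        ENNReal.ofReal (1 + η⁻¹) * volume (cell L) *
          (∫⁻ x in cell L, (∑ k : Fin 3, if Int.fract ((M : ℝ) * x k / L) < w then (1 : ℝ≥0∞) else 0) *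
            (‖f x‖₊ : ℝ≥0∞) ^ 2) := by
  set wellSet : Set Space := {x : Space | ∀ k, w ≤ Int.fract ((M : ℝ) * x k / L)} with hwS
  have hint : IntegrableOn f (cell L) := integrableOn_cell hf
  have hmeas : MeasurableSet wellSet := measurableSet_wellSet M L w
  rw [← integral_inter_add_sdiff hmeas hint]
  refine (ennnorm_add_sq_le hη _ _).trans (add_le_add ?_ ?_)
  · rw [mul_assoc]
    refine mul_le_mul_right ?_ _
    calc ((‖∫ x in cell L ∩ wellSet, f x‖₊ : ℝ≥0∞)) ^ 2
        ≤ volume (cell L ∩ wellSet) *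
            ∫⁻ x in cell L ∩ wellSet, (‖f x‖₊ : ℝ≥0∞) ^ 2 :=
          CoarseCellLorentzian.CellPairSumRule.sq_nnnorm_setIntegral_le hf.aestronglyMeasurable
      _ ≤ volume (cell L ∩ wellSet) * ∫⁻ x in cell L, (‖f x‖₊ : ℝ≥0∞) ^ 2 :=
          mul_le_mul_right (lintegral_mono_set Set.inter_subset_left) _
  · rw [mul_assoc]
    refine mul_le_mul_right ?_ _
    calc ((‖∫ x in cell L \ wellSet, f x‖₊ : ℝ≥0∞)) ^ 2
        ≤ volume (cell L \ wellSet) *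
            ∫⁻ x in cell L \ wellSet, (‖f x‖₊ : ℝ≥0∞) ^ 2 :=
          CoarseCellLorentzian.CellPairSumRule.sq_nnnorm_setIntegral_le hf.aestronglyMeasurable
      _ ≤ volume (cell L) * ∫⁻ x in cell L \ wellSet,
            (∑ k : Fin 3, if Int.fract ((M : ℝ) * x k / L) < w then (1 : ℝ≥0∞) else 0) *
              (‖f x‖₊ : ℝ≥0∞) ^ 2 := by
          refine mul_le_mul' (measure_mono Set.sdiff_subset) ?_
          refine setLIntegral_mono' ((measurableSet_cell L).diff hmeas) fun x hx => ?_
          calc ((‖f x‖₊ : ℝ≥0∞)) ^ 2 = 1 * ((‖f x‖₊ : ℝ≥0∞)) ^ 2 := (one_mul _).symm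
            _ ≤ (∑ k : Fin 3, if Int.fract ((M : ℝ) * x k / L) < w then (1 : ℝ≥0∞) else 0) *
                ((‖f x‖₊ : ℝ≥0∞)) ^ 2 :=
                mul_le_mul_left (one_le_wallWeight_of_not_mem hx.2) _
      _ ≤ volume (cell L) * ∫⁻ x in cell L,
            (∑ k : Fin 3, if Int.fract ((M : ℝ) * x k / L) < w then (1 : ℝ≥0∞) else 0) *
              (‖f x‖₊ : ℝ≥0∞) ^ 2 :=
          mul_le_mul_right (lintegral_mono_set Set.sdiff_subset) _

/-! ## The confinement bound on the constant-mode occupation -/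

/-- Tonelli along the first particle, restricted to the cells. [folklore] -/
theorem setLIntegral_cellN_succ {n : ℕ} (L : ℝ) {F : Config (n + 1) → ℝ≥0∞} (hF : Measurable F) :
    ∫⁻ X in cellN (n + 1) L, F X = ∫⁻ Y in cellN n L, ∫⁻ x in cell L, F (Matrix.vecCons x Y) := by
  set μ : Fin (n + 1) → Measure Space := fun _ => volume.restrict (cell L) with hμ
  have hmp := measurePreserving_piFinSuccAbove μ 0
  rw [volume_restrict_cellN, volume_restrict_cellN, hmp.symm.lintegral_map_equiv F]
  have hF' : ∀ z : Space × Config n,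
      F ((MeasurableEquiv.piFinSuccAbove (fun _ => Space) 0).symm z) = F (Matrix.vecCons z.1 z.2) := by
    rintro ⟨y, Y⟩
    have : (MeasurableEquiv.piFinSuccAbove (fun _ : Fin (n + 1) => Space) 0).symm (y, Y) =
        Matrix.vecCons y Y := by
      change Fin.insertNth 0 y Y = (Fin.cons y Y : Config (n + 1))
      exact Fin.insertNth_zero' y Y
    rw [this]
  simp only [hF']
  exact lintegral_prod_symm' _ (hF.comp measurable_vecCons_prod)

/-- **Confinement bound.** For a periodic trial state `Ψ` of `N` bosons on the torus of side `L > 0`, a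
muffin tin of `M ≥ 1` periods per axis and wall fraction `w ∈ [0,1]`, and every `η > 0`:
`n₀(Ψ) ≤ (1+η)(1-w)³·N + (1+η⁻¹)·N·⟨W⟩_Ψ`. [folklore] -/
theorem condensateOccupation_le_confinement {M : ℕ} (hM : 0 < M) (hL : 0 < L) {w : ℝ}
    (hw1 : w ≤ 1) {η : ℝ} (hη : 0 < η) (Ψ : PeriodicTrialState N L) :
    condensateOccupation N L Ψ.ψ ≤
      ENNReal.ofReal ((1 + η) * (1 - w) ^ 3) * N +
        ENNReal.ofReal (1 + η⁻¹) * N * wallEnergy N L M w Ψ.ψ := by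
  cases N with
  | zero => simp [condensateOccupation, occupation]
  | succ n =>
  have hΨc : Continuous Ψ.ψ := Ψ.contDiff.continuous
  have hΨm : Measurable Ψ.ψ := hΨc.measurable
  have hL3 : ENNReal.ofReal L ^ 3 ≠ 0 := pow_ne_zero _ (by simpa using hL)
  have hL3' : ENNReal.ofReal L ^ 3 ≠ ⊤ := ENNReal.pow_ne_top ENNReal.ofReal_ne_top
  -- the two densities on `cell^{n+1}`
  set F₁ : Config (n + 1) → ℝ≥0∞ := fun X => ((‖Ψ.ψ X‖₊ : ℝ≥0∞)) ^ 2 with hF₁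
  set F₂ : Config (n + 1) → ℝ≥0∞ := fun X =>
    (∑ k : Fin 3, if Int.fract ((M : ℝ) * X 0 k / L) < w then (1 : ℝ≥0∞) else 0) *
      ((‖Ψ.ψ X‖₊ : ℝ≥0∞)) ^ 2 with hF₂
  have hF₁m : Measurable F₁ := hΨm.nnnorm.coe_nnreal_ennreal.pow_const 2
  have hF₂m : Measurable F₂ :=
    ((measurable_wallWeight M L w).comp (measurable_pi_apply 0)).mul hF₁m
  set c₁ : ℝ≥0∞ := ENNReal.ofReal (1 + η) * ENNReal.ofReal ((1 - w) ^ 3) with hc₁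
  set c₂ : ℝ≥0∞ := ENNReal.ofReal (1 + η⁻¹) with hc₂
  -- pointwise bound on the squared annihilation amplitude
  have hpt : ∀ Y : Config n,
      ((‖modeAn L (constantMode L) Ψ.ψ Y‖₊ : ℝ≥0∞)) ^ 2 ≤
        (n + 1 : ℝ≥0∞) * (c₁ * (∫⁻ x in cell L, F₁ (Matrix.vecCons x Y)) +
          c₂ * (∫⁻ x in cell L, F₂ (Matrix.vecCons x Y))) := by
    intro Y
    have hf : Continuous fun x : Space => Ψ.ψ (Matrix.vecCons x Y) :=
      hΨc.comp (continuous_id.matrixVecCons continuous_const)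
    have hset : ∫ x in cell L, conj (constantMode L x) * Ψ.ψ (Matrix.vecCons x Y) =
        ((Real.sqrt (L ^ 3))⁻¹ : ℂ) * ∫ x in cell L, Ψ.ψ (Matrix.vecCons x Y) := by
      rw [← integral_const_mul]
      refine setIntegral_congr_fun (measurableSet_cell L) fun x hx => ?_
      simp [constantMode, Set.indicator_of_mem hx]
    rw [modeAn, hset, nnnorm_sqrt_mul_sq, coe_nnnorm_mul_sq, nnnorm_constantMode_sq hL]
    refine mul_le_mul_right ?_ _
    have hslice := sq_nnnorm_setIntegral_cell_le M L w hη hf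
    have hvol := volume_cell_inter_wellSet_le (w := w) hM hL hw1
    set A₁ : ℝ≥0∞ := ∫⁻ x in cell L, F₁ (Matrix.vecCons x Y) with hA₁
    set A₂ : ℝ≥0∞ := ∫⁻ x in cell L, F₂ (Matrix.vecCons x Y) with hA₂
    calc (ENNReal.ofReal L ^ 3)⁻¹ * ((‖∫ x in cell L, Ψ.ψ (Matrix.vecCons x Y)‖₊ : ℝ≥0∞)) ^ 2
        ≤ (ENNReal.ofReal L ^ 3)⁻¹ *
            (ENNReal.ofReal (1 + η) * ENNReal.ofReal ((1 - w) ^ 3 * L ^ 3) * A₁ +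
              ENNReal.ofReal (1 + η⁻¹) * (ENNReal.ofReal L ^ 3) * A₂) := by
          refine mul_le_mul_right (hslice.trans ?_) _
          rw [volume_cell]
          gcongr
          rw [hA₂]
          exact le_of_eq (lintegral_congr fun x => rfl)
      _ = c₁ * A₁ + c₂ * A₂ := by
          rw [ENNReal.ofReal_mul (by positivity : (0 : ℝ) ≤ (1 - w) ^ 3), ENNReal.ofReal_pow hL.le,
            mul_add]
          congr 1
          · rw [hc₁]
            calc (ENNReal.ofReal L ^ 3)⁻¹ *
                  (ENNReal.ofReal (1 + η) * (ENNReal.ofReal ((1 - w) ^ 3) * ENNReal.ofReal L ^ 3) * A₁)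
                = ((ENNReal.ofReal L ^ 3)⁻¹ * ENNReal.ofReal L ^ 3) *
                    (ENNReal.ofReal (1 + η) * ENNReal.ofReal ((1 - w) ^ 3) * A₁) := by ring
              _ = _ := by rw [ENNReal.inv_mul_cancel hL3 hL3', one_mul]
          · rw [hc₂]
            calc (ENNReal.ofReal L ^ 3)⁻¹ * (ENNReal.ofReal (1 + η⁻¹) * ENNReal.ofReal L ^ 3 * A₂)
                = ((ENNReal.ofReal L ^ 3)⁻¹ * ENNReal.ofReal L ^ 3) * (ENNReal.ofReal (1 + η⁻¹) * A₂) := by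
                  ring
              _ = _ := by rw [ENNReal.inv_mul_cancel hL3 hL3', one_mul]
  -- measurability of the two slice integrals in `Y`
  have hI₁ : Measurable fun Y : Config n => ∫⁻ x in cell L, F₁ (Matrix.vecCons x Y) :=
    (hF₁m.comp (measurable_vecCons_prod.comp measurable_swap)).lintegral_prod_right'
  have hI₂ : Measurable fun Y : Config n => ∫⁻ x in cell L, F₂ (Matrix.vecCons x Y) :=
    (hF₂m.comp (measurable_vecCons_prod.comp measurable_swap)).lintegral_prod_right'
  -- integrate over `Y`
  have hc₁top : c₁ ≠ ⊤ := ENNReal.mul_ne_top ENNReal.ofReal_ne_top ENNReal.ofReal_ne_top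
  have hc₂top : c₂ ≠ ⊤ := ENNReal.ofReal_ne_top
  have hN : (n + 1 : ℝ≥0∞) = ((n + 1 : ℕ) : ℝ≥0∞) := by push_cast; ring
  rw [condensateOccupation_eq_lintegral_modeAn_constantMode]
  calc ∫⁻ Y in cellN n L, ((‖modeAn L (constantMode L) Ψ.ψ Y‖₊ : ℝ≥0∞)) ^ 2
      ≤ ∫⁻ Y in cellN n L, (n + 1 : ℝ≥0∞) * (c₁ * (∫⁻ x in cell L, F₁ (Matrix.vecCons x Y)) +
          c₂ * (∫⁻ x in cell L, F₂ (Matrix.vecCons x Y))) := lintegral_mono fun Y => hpt Y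
    _ = (n + 1 : ℝ≥0∞) * (c₁ * (∫⁻ Y in cellN n L, ∫⁻ x in cell L, F₁ (Matrix.vecCons x Y)) +
          c₂ * (∫⁻ Y in cellN n L, ∫⁻ x in cell L, F₂ (Matrix.vecCons x Y))) := by
        rw [lintegral_const_mul' _ _ (by simp), lintegral_add_left' ((hI₁.const_mul c₁).aemeasurable),
          lintegral_const_mul' _ _ hc₁top, lintegral_const_mul' _ _ hc₂top]
    _ = (n + 1 : ℝ≥0∞) * (c₁ * (∫⁻ X in cellN (n + 1) L, F₁ X) + c₂ * (∫⁻ X in cellN (n + 1) L, F₂ X)) := by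
        rw [← setLIntegral_cellN_succ L hF₁m, ← setLIntegral_cellN_succ L hF₂m]
    _ ≤ (n + 1 : ℝ≥0∞) * (c₁ * 1 + c₂ * wallEnergy (n + 1) L M w Ψ.ψ) := by
        gcongr
        · exact Ψ.norm_eq.le
        · unfold wallEnergy
          exact lintegral_mono fun X => mul_le_mul_left (wallWeight_le_wallCount M L w X) _
    _ = ENNReal.ofReal ((1 + η) * (1 - w) ^ 3) * ((n + 1 : ℕ) : ℝ≥0∞) +
          ENNReal.ofReal (1 + η⁻¹) * ((n + 1 : ℕ) : ℝ≥0∞) * wallEnergy (n + 1) L M w Ψ.ψ := by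
        rw [hN, hc₁, hc₂, ← ENNReal.ofReal_mul (by positivity)]
        ring

end DownSandwich

/-- **Registered sub-goal `downSandwich_confinementBound`** (lead's DOWN direction for `stub_deepWallGerm`, part 1):
the confinement bound `n₀(Ψ) ≤ (1+η)(1-w)³·N + (1+η⁻¹)·N·⟨W⟩_Ψ` for every periodic trial state, every muffin tin with
`M ≥ 1` periods and wall fraction `w ≤ 1`, and every `η > 0`. [folklore] -/
theorem downSandwich_confinementBound :
    ∀ (N : ℕ) (L : ℝ) (M : ℕ), 0 < M → 0 < L → ∀ (w : ℝ), w ≤ 1 → ∀ (η : ℝ), 0 < η →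
      ∀ Ψ : PeriodicTrialState N L,
        condensateOccupation N L Ψ.ψ ≤
          ENNReal.ofReal ((1 + η) * (1 - w) ^ 3) * N +
            ENNReal.ofReal (1 + η⁻¹) * N * wallEnergy N L M w Ψ.ψ :=
  fun _ _ _ hM hL _ hw1 _ hη Ψ => DownSandwich.condensateOccupation_le_confinement hM hL hw1 hη Ψ

end Summit.AtomisticToContinuum.BoseEinsteinCondensation.Cruxes.LatticeToPeriodicBridge.MuffinTinRewardSupermodularity

end
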